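import Summits.HodgeConjecture.CorCM.Census.DecicCyclicSpecies

/-!
# Decic atlas, type `ℤ/10` (sequel): the two codimension-2 atoms of a cyclic decic CM field ARE the general Hodge conjecture `GHC(B₀; 3, 1)` for one simple CM fivefold (kernel census)

COR-CM (cell `pub-hodgecm2`), count-neutral kernel census by the PORTFOLIO seat lit-andre-3 (gen 10, ask A6-R20), sequel of
`Census/DecicCyclicSpecies.lean` (imported BY NAME: `Pt`, `e`, `q`, `act`, `phi`, `hodgeForm`, `wt`, `orbitRep`, `sanity`) and the exact
analogue, one order up, of `Census/OcticCyclicConiveau.lean` (gen 9).  No named fact, no geometry, no `sorry`: `decide`, `simp`, `omega`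
and three small structural lemmas.  Cell note `HOME/pub-hodgecm2-lit-andre-3/PORTFOLIO-lit-andre-3-g10.md` §2.  Companion (same session):
`Census/DecicCyclicWeilPlanes.lean` (the `E`-atom = Weil planes, and the sub-families `E^a × B_j^b`).

SETTING (gen 10, `DecicCyclicSpecies`): `F` cyclic CM of degree `10`, `G = ℤ/10 = ⟨σ⟩`, `c = σ⁵`, `k = F^{⟨σ²⟩}` imaginary quadratic; simple
factors `E` (CM by `k`), fivefolds `B₀` (type `{0,1,2,3,4}`), `B₁` (`{0,1,2,4,8}`, the `Aut`-invariant class), `B₂` (`{0,1,3,4,7}`); the Hodge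
lattice of every `E^a × B₀^b × B₁^c × B₂^d` is `ℤ⟨divisor classes⟩ + 3` Galois orbits: the Weil plane of `E × B₀` (algebraic by Markman's split
sixfold theorem, loc. cit.) and two orbits of size `10`, `R₁ = e_{1,2} ⊗ e_{0,{3,7,9}}` on `B₁ × B₀`, `R₂ = e_{2,1} ⊗ e_{0,{3,6,9}}` on `B₂ × B₀`
(Künneth `(1,3)`, codimension `2`).

KERNEL.  `pcount`/`lab` and `hodgeForm_wt` (PROVED, general: Pohlmann's form of a square-free monomial is `2p − |P|`), `hodge_wt_iff`,
`hodgeForm_wt_eq_iff`; FAST TYPE BITS `bit`/`ebit`/`pc` (bitmasks of the block types) with the certificates `bit_iff`, `ebit_iff` and the PROVED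
bridges `pcount_lab`, `pcount_q_union_lab`, `pcount_e_union_lab`, `pcount_image_act`, `hodge_translate_iff` (Galois equivariance) — the census
statements are in fast form and these convert them to "all ten Pohlmann forms vanish".
`h3_level_census`: each `H³(B_i, ℚ̄)` = `120` eigenlines (`12` Galois orbits of `10`); `40` through a conjugate pair (`NS ∧ H¹`, divisorial);
the PAIRLESS level-`≤ 1` lines are, for `B₀`, exactly the orbits `N₁ = N_{{0,2,6}}`, `N₂ = N_{{0,3,6}}`; for `B₂` the orbits `N₀″ = N_{{0,1,2}}`,
`N₁″ = N_{{0,2,4}}`; for `B₁` NONE (every pairless piece of `H³(B₁)` has a `(3,0)`-line).  `types_N` (Hodge numbers `(2,1)⁵(1,2)⁵`);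
`types_pair_triples` (pair orbits ≅ `H¹(B_i)(−1)`); `levelOne_pieces_are_H1`: `G`-EQUIVARIANT type matchings `N₁(1) ≅ H¹(B₁)`, `N₂(1) ≅ H¹(B₂)`,
`N₀″(1) ≅ H¹(B₀)`, `N₁″(1) ≅ H¹(B₁)` (with Riemann: the pieces are `H¹` of fivefolds isogenous to `B₁, B₂, B₀, B₁`, twisted once);
`levelOne_multiplicity_one` (each of the four pieces has multiplicity one in its `H³`, among all `120` lines).  `hodge13_iff` (+ `hodge_translate_iff`):
`e_{1,s} ⊗ e_{0,S}` (`|S| = 3`) is a Hodge class iff `S = {s+1,s+5,s+7}`, `e_{2,s} ⊗ e_{0,S}` iff `S = {s+2,s+5,s+8}` — by `hodge13_orbitRep` the translates of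
`orbitRep 1`, `orbitRep 2`: `Hom_HS(H¹(B_j)(−1)^tw, H³(B₀))` is ONE `F`-line, landing in `N_j`; `hodge13_mirror_iff` (the `σ ↦ σ³` mirror into
`H³(B₂)`); `hodge13_none` (no graph class lands in `H³(B₁)`, none starts at `E`).

THEOREM (informal; complete modulo the cited dictionary, exactly as in `OcticCyclicConiveau` §THEOREM, and modulo the Markman record
`Markman2025_weilClasses_algebraic_hyperbolicSixfold` for the `E`-atom).  For a cyclic decic CM field `F` with factors `E, B₀, B₁, B₂`, TFAE:
  (i)   HC for every `E^a × B₀^b × B₁^c × B₂^d` (= every abelian variety all of whose simple factors have CM field inside `F`);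
  (ii)  one algebraic `2`-cycle on `B₁ × B₀` with a non-zero `R₁`-coordinate and one on `B₂ × B₀` with a non-zero `R₂`-coordinate;
  (iii) Grothendieck's (amended) general Hodge conjecture for `E, B₀, B₁, B₂`, all degrees and coniveaux;
  (iv)  `GHC(B₀; 3, 1)`: `N₁ ⊕ N₂ ⊂ N¹H³(B₀, ℚ)` — the two rank-`10` level-one pieces are supported on a divisor of `B₀`;
  (iv′) `GHC(B₂; 3, 1)` for `N₀″ ⊕ N₁″`;
  (v)   there are smooth projective fourfolds `T_j` with morphisms `f_j : T_j → B_j`, `ι_j : T_j → B₀` such that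
        `ι_{j*} f_j^* : H¹(B_j, ℚ) → H³(B₀, ℚ)(1)` is non-zero (`j = 1, 2`).
 (i)⟹(iii): every `B_i` (and `E`) is `ℂ`-dominated INSIDE the slice (domination census of the cell note §2.4: `89/99/89` of the `108` orbit rows of
   `B₀/B₁/B₂` are dominated by `B_i` itself through divisor-induced isomorphisms, the others by `B_j`, `E`, `E³` or two-factor products), so
   HC on the slice gives GHC [Abdulali 2016 Prop. 3.2 + Lemma 3.3 = Grothendieck; proof 1997 Prop. 2.1].  (iii)⟹(iv): `h3_level_census`
   [Grothendieck 1969 pp. 300–301].  (iv)⟹(v): `N¹H³(B₀) = Σ` Gysin images of `H¹(T)(−1)` over desingularised divisors `T → B₀` [Abdulali 1997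
   p. 343; Deligne, Hodge II 8.2.8]; `H¹(Alb T)` is semisimple, so a summand maps isomorphically onto `N_j`, and `N_j(1) ≅ H¹(B_j)`
   (`levelOne_pieces_are_H1` + Riemann) makes `B_j` an isogeny factor of `Alb T` (Poincaré); compose.  (v)⟹(ii): `Γ_j = (f_j, ι_j)_*[T_j] ∈
   CH⁶(B_j × B₀)` acts by `ι_{j*} f_j^* ≠ 0` on the irreducible `H¹(B_j)`, so onto `N_j(1)`; the Künneth `(9,3)`-component of `[Γ_j]` is algebraic
   [Lieberman/Kleiman on abelian varieties], and Lieberman's algebraic `Λ⁴_{B_j} ⊗ id` (`L⁴ : H¹(B_j) ≅ H⁹(B_j)`) turns it into a non-zero rational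
   algebraic class in `H¹(B_j) ⊗ N_j ⊂ H⁴(B_j × B₀)`, all of whose eigen-coordinates sit on the `R_j`-orbit (`hodge13_iff`).  (ii)⟹(i): the lattice
   theorem `DecicCyclicSpecies.isHodgeVec_iff` with (O1)–(O4) of `Census/DihedralFourCoreLattice.lean` and Markman for `R₀`.  (iv′): `σ ↦ σ³`.  ∎
COROLLARY (unconditional part, cell note §2.4).  For a simple CM abelian fivefold `B` with CM by a cyclic decic field: HC holds for all powers of
`B` (nondegenerate; b04 `isNondegenerate_of_isPrimitive_of_isCyclic`), so GHC holds for every piece of `H^•(B)` dominated by `B` itself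
(`89`, `99`, `89` of `108` orbit rows for the three classes); the REMAINING pieces are: for `B₀` (and `B₂`) the level-one `N₁, N₂ ⊂ H³`,
five level-one pieces of `H⁵` (`≅ H¹(B_j)(−2)` and the rank-`2` `P₀ ≅ H¹(E)(−2)` — the latter SETTLED by Markman, `DecicCyclicWeilPlanes`),
two of `H⁷`, eight level-`2` pieces of `H⁴, H⁶` and two level-`3` pieces of `H⁵`; for `B₁` nine pieces, all of level `≥ 2` — consistent with
`h3_level_census`/`hodge13_none`: `B₁` carries no level-one obstruction, and HC(slice) is not readable on `B₁` alone.
PLACEMENT.  As for the octic type: `B₀` is not dominated by its own powers (its class is not `Aut`-stable … rather: `G` is not transitive on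
the primitive types — three orbits), so Abdulali's list of known CM cases [2016 App. A (3); 2005 §4] does not contain it; Hazama 1994 Thm 5.1
is for types I/II.  `F = ℚ(ζ₁₁)`: (i) is KNOWN (Fermat level `22`), hence (iii)–(v) HOLD for the three simple CM fivefolds of `J(F₁₁)`-type —
an unconditional instance of GHC in weight `3` not in the printed lists (cell note §2.5).  `F ⊂ ℚ(ζ₃₁)`: open (`DecicFermatCoverage31`).

## References
* [Pohlmann1968] H. Pohlmann, Ann. of Math. 88 (1968), Thm 1.  [GrothendieckTopology1969] A. Grothendieck, Hodge's general conjecture is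
  false for trivial reasons, Topology 8 (1969), pp. 300–301.
* [Abdulali1997AVTypeIII] S. Abdulali, Abelian varieties and the general Hodge conjecture, Compositio Math. 109 (1997), Prop. 2.1 (pp. 343–344).
* [Abdulali2016TateTwists] S. Abdulali, Tate twists of Hodge structures arising from abelian varieties, in: Recent Advances in Hodge Theory
  (LMS LN 427, 2016), Def. 3.1, Prop. 3.2, Lemma 3.3, Thm 5.2, App. A.  [Markman2025SecantWeil] E. Markman, arXiv:2502.03415, Thm 1.5.1.

## Provenance
Exact oracles (seat folder `scratch/`, copies in `HOME/pub-hodgecm2-lit-andre-3/g10/`): `probe10.py` (levels, matchings, graph and Weil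
characterisations, multiplicity one, sub-slices), `g9/domatlas10.py` (domination tables), `gen_coniveau10.py` (this file).
-/

namespace Summit.HodgeConjecture.CorCM.Census.DecicCyclicConiveau

open Finset
open Summit.HodgeConjecture.CorCM.Census.DecicCyclicSpecies

/-! ## Hodge types of square-free monomials; fast type bits -/

/-- The `p` of the Hodge type `(p, |P| - p)` of the square-free class monomial `e_P = ⊗_{x ∈ P} e_x` for the `g`-conjugate complex
structure (equivalently: of the Galois-conjugate eigenline `e_{g·P}`): the number of labels of `P` that `g` moves into `Φ`. [cite: Pohlmann1968, Thm 1] -/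
def pcount (g : ZMod 10) (P : Finset Pt) : ℕ := (P.filter fun x => act g x ∈ phi).card

/-- The labels of the fivefold `B_i` indexed by a set of exponents `S ⊆ ℤ/10`: the wedge monomial `e_{i,S} ∈ H^{|S|}(B_i)`. [folklore] -/
def lab (i : Fin 3) (S : Finset (ZMod 10)) : Finset Pt := S.image (q i)

/-- Pohlmann's Hodge form of a square-free monomial is `p - q = 2p - |P|`. [cite: Pohlmann1968, Thm 1] -/
theorem hodgeForm_wt (g : ZMod 10) (P : Finset Pt) :
    hodgeForm g (wt P) = 2 * (pcount g P : ℤ) - (P.card : ℤ) := by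
  have h1 : ∀ x : Pt, (if act g x ∈ phi then wt P x else -wt P x)
      = if x ∈ P then (if act g x ∈ phi then (1 : ℤ) else -1) else 0 := by
    intro x; unfold wt; split_ifs <;> simp
  unfold hodgeForm pcount
  simp_rw [h1]
  rw [Finset.sum_ite_mem, Finset.univ_inter, Finset.sum_ite, Finset.sum_const, Finset.sum_const,
    ← Finset.card_filter_add_card_filter_not (s := P) (fun x => act g x ∈ phi)]
  simp only [nsmul_eq_mul, Nat.cast_add, mul_one, mul_neg]
  ring

/-- A square-free monomial is a Hodge class (all ten Pohlmann forms vanish) iff every Galois conjugate has type `(p, p)`, `2p = |P|`.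
[cite: Pohlmann1968, Thm 1] -/
theorem hodge_wt_iff (P : Finset Pt) : (∀ g, hodgeForm g (wt P) = 0) ↔ ∀ g, 2 * pcount g P = P.card := by
  refine forall_congr' fun g => ?_
  rw [hodgeForm_wt]
  omega

/-- `e_P` and `e_Q` span, with their Galois conjugates, `ℚ`-Hodge structures ISOMORPHIC UP TO A TATE TWIST iff all Pohlmann forms agree;
in type language `2·pcount g P - |P| = 2·pcount g Q - |Q|` for all `g` (dictionary (D) of `Census/DihedralFourCoreLattice.lean`). [cite: Pohlmann1968, Thm 1] -/
theorem hodgeForm_wt_eq_iff (P Q : Finset Pt) :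
    (∀ g, hodgeForm g (wt P) = hodgeForm g (wt Q)) ↔ ∀ g, 2 * pcount g P + Q.card = 2 * pcount g Q + P.card := by
  refine forall_congr' fun g => ?_
  rw [hodgeForm_wt, hodgeForm_wt]
  omega

/-- Bitmasks of the three block types `{0,1,2,3,4}`, `{0,1,2,4,8}`, `{0,1,3,4,7}` (bit `t` set iff `t` is in the type): the census below reads
Hodge types through these (kernel-cheap) instead of through membership in `phi`; `bit_iff`, `ebit_iff` certify the translation. [folklore] -/
def mask : Fin 3 → ℕ := ![31, 279, 155]

/-- Fast type bit: `e_{i,t}` has type `(1,0)` for the `g`-conjugate complex structure iff `g + t ∈ blockType (i+1)`. [folklore] -/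
def bit (i : Fin 3) (g t : ZMod 10) : Bool := (mask i).testBit (g + t).val

/-- Fast type bit for `E`: `e_u` is `(1,0)` for the `g`-conjugate structure iff `u + g ≡ 0 (mod 2)`. [folklore] -/
def ebit (g : ZMod 10) (u : ZMod 2) : Bool := (u.val + g.val) % 2 == 0

/-- `bit` computes membership of the conjugate label in the total type `Φ` of `DecicCyclicSpecies`. [folklore] -/
theorem bit_iff (i : Fin 3) (g t : ZMod 10) : act g (q i t) ∈ phi ↔ bit i g t = true := by
  revert i g t; decide

/-- `ebit` computes membership of the conjugate `E`-label in `Φ`. [folklore] -/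
theorem ebit_iff (g : ZMod 10) (u : ZMod 2) : act g (e u) ∈ phi ↔ ebit g u = true := by
  revert g u; decide

/-- Fast `p`-count of the wedge monomial `e_{i,S}` (`= pcount g (lab i S)`, `pcount_lab`). [folklore] -/
def pc (i : Fin 3) (g : ZMod 10) (S : Finset (ZMod 10)) : ℕ := (S.filter fun t => bit i g t = true).card

/-- `pcount` is additive on disjoint label sets. [folklore] -/
theorem pcount_union (g : ZMod 10) (A B : Finset Pt) (h : Disjoint A B) : pcount g (A ∪ B) = pcount g A + pcount g B := by
  unfold pcount
  rw [Finset.filter_union, Finset.card_union_of_disjoint (Finset.disjoint_filter_filter h)]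

/-- `pcount` of a single label. [folklore] -/
theorem pcount_singleton (g : ZMod 10) (x : Pt) : pcount g {x} = if act g x ∈ phi then 1 else 0 := by
  unfold pcount
  rw [Finset.filter_singleton]
  split_ifs <;> simp

/-- `pcount` of a wedge monomial of one fivefold is the fast count. [folklore] -/
theorem pcount_lab (i : Fin 3) (g : ZMod 10) (S : Finset (ZMod 10)) : pcount g (lab i S) = pc i g S := by
  unfold pcount lab pc
  rw [Finset.filter_image, Finset.card_image_of_injective]
  · congr 1
    ext t
    simp only [Finset.mem_filter, bit_iff]
  · intro a b hab
    simpa using hab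

/-- **Bridge for the Künneth-`(1,3)` / `(1,5)` monomials**: `pcount` of `e_{j,s} ⊗ e_{i,S}` (`j ≠ i`) in fast form; with `hodge_wt_iff` the
monomial is a Hodge class iff `∀ g, 2·(bit + pc) =` its degree. [folklore] -/
theorem pcount_q_union_lab (j i : Fin 3) (h : j ≠ i) (s g : ZMod 10) (S : Finset (ZMod 10)) :
    pcount g ({q j s} ∪ lab i S) = (if bit j g s = true then 1 else 0) + pc i g S := by
  have hd : Disjoint ({q j s} : Finset Pt) (lab i S) := by
    rw [Finset.disjoint_singleton_left]
    unfold lab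
    simp only [Finset.mem_image, not_exists, not_and]
    intro t _ ht
    have h1 : i = j ∧ t = s := by simpa [q] using ht
    exact h h1.1.symm
  rw [pcount_union _ _ _ hd, pcount_singleton, pcount_lab]
  simp only [bit_iff]

/-- Bridge for `e_u ⊗ e_{i,S}` on `E × B_i`. [folklore] -/
theorem pcount_e_union_lab (u : ZMod 2) (i : Fin 3) (g : ZMod 10) (S : Finset (ZMod 10)) :
    pcount g ({e u} ∪ lab i S) = (if ebit g u = true then 1 else 0) + pc i g S := by
  have hd : Disjoint ({e u} : Finset Pt) (lab i S) := by
    rw [Finset.disjoint_singleton_left]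
    unfold lab
    simp
  rw [pcount_union _ _ _ hd, pcount_singleton, pcount_lab]
  simp only [ebit_iff]

/-- `act` is a `G`-action (from `DecicCyclicSpecies.sanity`). [folklore] -/
theorem act_add (g h : ZMod 10) (x : Pt) : act (g + h) x = act g (act h x) := sanity.2.1 g h x

/-- Each `act h` is injective (its inverse is `act (-h)`). [folklore] -/
theorem act_injective (h : ZMod 10) : Function.Injective (act h) := by
  intro a b hab
  have e1 := congrArg (act (-h)) hab
  rw [← act_add, ← act_add, neg_add_cancel, sanity.2.2, sanity.2.2] at e1
  exact e1

/-- **Galois equivariance of the type count**: translating a monomial by `h` shifts the conjugate: `p_g(e_{h·P}) = p_{g+h}(e_P)`. [cite: Pohlmann1968, Thm 1] -/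
theorem pcount_image_act (g h : ZMod 10) (P : Finset Pt) : pcount g (P.image (act h)) = pcount (g + h) P := by
  unfold pcount
  rw [Finset.filter_image, Finset.card_image_of_injective _ (act_injective h)]
  congr 1
  ext x
  simp only [Finset.mem_filter, act_add]

/-- Hence "`e_P` is a Hodge class" (all conjugates of type `(p,p)`) is invariant under translation of `P`: the `∀ s` forms of the graph
statements below follow from their `s = 0` instances, since `{q j s} ∪ lab i (S + s) = ({q j 0} ∪ lab i S).image (act s)`. [folklore] -/
theorem hodge_translate_iff (h : ZMod 10) (P : Finset Pt) (k : ℕ) :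
    (∀ g, 2 * pcount g (P.image (act h)) = k) ↔ (∀ g, 2 * pcount g P = k) := by
  simp only [pcount_image_act]
  constructor
  · intro H g
    simpa using H (g - h)
  · intro H g
    exact H (g + h)

/-! ## `H³` of the three simple fivefolds: orbits, levels, the level-one pieces -/

/-- The `120` three-element exponent sets: the eigenlines `e_{i,S}` of `H³(B_i, ℚ̄) = Λ³ H¹`. [folklore] -/
def triples : Finset (Finset (ZMod 10)) := univ.powersetCard 3

/-- `S` contains a conjugate pair `{t, t+5}` (the monomial is a divisor class times `H¹`). [folklore] -/
def hasPair (S : Finset (ZMod 10)) : Bool := decide (∃ t ∈ S, t + 5 ∈ S)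

/-- The translation (= Galois) orbit of an exponent set: the eigenlines spanning ONE `ℚ`-sub-Hodge structure `N_S ⊂ H^{|S|}(B_i, ℚ)`
(an isotypic piece for the Mumford–Tate torus). [folklore] -/
def torb (S : Finset (ZMod 10)) : Finset (Finset (ZMod 10)) := univ.image fun g : ZMod 10 => S.image (g + ·)

/-- LEVEL `≤ 1` for a weight-3 piece of `B_i`: no Galois conjugate of `e_{i,S}` has type `(3,0)` or `(0,3)`, i.e. `N_S ⊂ F¹H³`
(Grothendieck's amended GHC then asks `N_S ⊂ N¹H³`). [cite: GrothendieckTopology1969, pp. 300–301] -/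
def levelLEOne (i : Fin 3) (S : Finset (ZMod 10)) : Bool := decide (∀ g : ZMod 10, 1 ≤ pc i g S ∧ pc i g S ≤ 2)

/-- The set of conjugates `g` at which `e_{i,S}` has `p = 2` (for a level-one triple: its Hodge type vector). [folklore] -/
def typeSet (i : Fin 3) (S : Finset (ZMod 10)) : Finset (ZMod 10) := univ.filter fun g => pc i g S = 2

/-- The full type vector `g ↦ p_g` of `e_{i,S}`, as a graph (the Mumford–Tate character of the eigenline). [folklore] -/
def typeGraph (i : Fin 3) (S : Finset (ZMod 10)) : Finset (ZMod 10 × ℕ) := univ.image fun g => (g, pc i g S)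

/-- Orbit representatives of the level-one PAIRLESS pieces: `N₁ = N_{{0,2,6}}`, `N₂ = N_{{0,3,6}} ⊂ H³(B₀, ℚ)` and
`N₀″ = N_{{0,1,2}}`, `N₁″ = N_{{0,2,4}} ⊂ H³(B₂, ℚ)` (rank `10` each). [folklore] -/
def repN : Fin 4 → Finset (ZMod 10) := ![{0, 2, 6}, {0, 3, 6}, {0, 1, 2}, {0, 2, 4}]

set_option maxRecDepth 8000 in
/-- **`H³` census.**  For each simple fivefold `B_i`: `H³(B_i, ℚ̄)` has `120` eigenlines (`12` Galois orbits of `10`); `40` lines (`4` orbits)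
pass through a conjugate pair (`NS(B_i) ∧ H¹(B_i)`: divisorial, coniveau `1` by Lefschetz `(1,1)`); the PAIRLESS lines of level `≤ 1` (inside
`F¹H³`) are: for `B₀` EXACTLY the two orbits of `{0,2,6}` and `{0,3,6}` (`N₁`, `N₂`), for `B₂` exactly the orbits of `{0,1,2}` and `{0,2,4}`, and
for `B₁` there are NONE (every pairless piece of `H³(B₁)` contains a `(3,0)`-line: no coniveau condition in `H³(B₁)` beyond the divisorial
part). [folklore] -/
theorem h3_level_census :
    triples.card = 120 ∧ (triples.filter fun S => hasPair S).card = 40 ∧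
    ((triples.filter fun S => levelLEOne 0 S) = (triples.filter fun S => hasPair S) ∪ torb (repN 0) ∪ torb (repN 1)) ∧
    ((triples.filter fun S => levelLEOne 1 S) = (triples.filter fun S => hasPair S)) ∧
    ((triples.filter fun S => levelLEOne 2 S) = (triples.filter fun S => hasPair S) ∪ torb (repN 2) ∪ torb (repN 3)) ∧
    (∀ k, (torb (repN k)).card = 10 ∧ ∀ S ∈ torb (repN k), hasPair S = false) := by
  refine ⟨by decide +kernel, by decide +kernel, by decide +kernel, by decide +kernel, by decide +kernel, by decide +kernel⟩

/-- The Hodge types of the four level-one pieces, conjugate by conjugate (`(2,1)` at the listed `g`, else `(1,2)`: Hodge numbers `(2,1)⁵(1,2)⁵`). [folklore] -/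
theorem types_N : typeSet 0 (repN 0) = {0, 1, 2, 4, 8} ∧ typeSet 0 (repN 1) = {0, 1, 4, 7, 8} ∧ typeSet 2 (repN 2) = {0, 1, 2, 3, 9} ∧ typeSet 2 (repN 3) = {0, 1, 3, 7, 9} := by
  refine ⟨by decide +kernel, by decide +kernel, by decide +kernel, by decide +kernel⟩

/-- The pair orbits are `H¹` up to the twist by a divisor class: the type of `e_t ∧ e_{t+5} ∧ e_y` is the type of `e_y` plus `(1,1)`. [folklore] -/
theorem types_pair_triples :
    ∀ i : Fin 3, ∀ t y : ZMod 10, y ≠ t → y ≠ t + 5 → ∀ g : ZMod 10, pc i g {t, t + 5, y} = pc i g {y} + 1 := by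
  decide +kernel

/-- **The level-one pieces are twisted `H¹`'s of OTHER factors** (type level, for EVERY conjugate complex structure `g`, with
`G`-equivariant matchings): `e_{1,t}` is `(1,0)` iff the `N₁`-line `e_{0,{t,t+2,t+6}}` is `(2,1)` — `N₁(1) ≅ H¹(B₁, ℚ)`; `e_{2,t}` is `(1,0)` iff
`e_{0,{t,t+3,t+7}}` is `(2,1)` — `N₂(1) ≅ H¹(B₂, ℚ)`; and in `H³(B₂)`: `e_{0,t} ↔ e_{2,{t,t+1,t+9}}` (`N₀″(1) ≅ H¹(B₀)`), `e_{1,t} ↔ e_{2,{t+1,t+3,t+9}}`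
(`N₁″(1) ≅ H¹(B₁)`).  With Riemann's theorem these pieces are the `H¹` of fivefolds isogenous to `B₁, B₂, B₀, B₁`, Tate-twisted once. [folklore] -/
theorem levelOne_pieces_are_H1 :
    (∀ g t : ZMod 10, bit 1 g t = true ↔ pc 0 g {t, t + 2, t + 6} = 2) ∧
    (∀ g t : ZMod 10, bit 2 g t = true ↔ pc 0 g {t, t + 3, t + 7} = 2) ∧
    (∀ g t : ZMod 10, bit 0 g t = true ↔ pc 2 g {t, t + 1, t + 9} = 2) ∧
    (∀ g t : ZMod 10, bit 1 g t = true ↔ pc 2 g {t + 1, t + 3, t + 9} = 2) := by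
  refine ⟨by decide +kernel, by decide +kernel, by decide +kernel, by decide +kernel⟩

set_option maxRecDepth 8000 in
/-- **Multiplicity one for the level-one pieces.**  Among ALL `120` eigenlines of `H³(B_i)` (pair-containing ones included) the type vector
(`typeGraph`) of each level-one representative occurs exactly once: `N₁`, `N₂` (in `H³(B₀)`) and `N₀″`, `N₁″` (in `H³(B₂)`) are irreducible `ℚ`-Hodge
structures of multiplicity one, met by no other isotypic piece of `H³` — so every `ℚ`-sub-Hodge structure of `F¹H³(B₀)` is `(sub of NS ∧ H¹) ⊕
(N₁ and/or N₂)`, and `GHC(B₀; 3, 1) ⟺ N₁ ⊕ N₂ ⊂ N¹H³(B₀, ℚ)` (similarly for `B₂`; for `B₁` the condition is empty by `h3_level_census`). [folklore] -/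
theorem levelOne_multiplicity_one : ∀ k : Fin 4,
    (triples.filter fun S => typeGraph (![0, 0, 2, 2] k) S = typeGraph (![0, 0, 2, 2] k) (repN k)) = {repN k} := by
  decide +kernel

/-! ## The graph classes: Künneth `(1,3)` Hodge monomials on `B_j × B_i` (fast form; `hodge_wt_iff` + the bridges convert) -/

set_option maxRecDepth 8000 in
set_option maxHeartbeats 1600000 in
/-- **The `(1,3)` Hodge monomials on `B_j × B₀` are exactly the two atom orbits.**  `e_{1,0} ⊗ e_{0,S}` (`|S| = 3`) is a Hodge class iff
`S = {1, 5, 7}`, and `e_{2,0} ⊗ e_{0,S}` iff `S = {2, 5, 8}`; by `hodge_translate_iff` (translate by `s`) `e_{1,s} ⊗ e_{0,S}` is Hodge iff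
`S = {s+1, s+5, s+7}` and `e_{2,s} ⊗ e_{0,S}` iff `S = {s+2, s+5, s+8}` — by `hodge13_orbitRep` exactly the `G`-translates of `orbitRep 1`,
`orbitRep 2`: `Hom_HS(H¹(B_j)(-1)^tw, H³(B₀))` is ONE `F`-line landing in `N_j` (`j = 1, 2`).  Fast type form: by `hodge_wt_iff` and
`pcount_q_union_lab` the left sides say "all ten Pohlmann forms of the monomial vanish". [cite: Pohlmann1968, Thm 1] -/
theorem hodge13_iff :
    (∀ S ∈ triples, (∀ g : ZMod 10, 2 * ((if bit 1 g 0 = true then 1 else 0) + pc 0 g S) = 4) ↔ S = {1, 5, 7}) ∧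
    (∀ S ∈ triples, (∀ g : ZMod 10, 2 * ((if bit 2 g 0 = true then 1 else 0) + pc 0 g S) = 4) ↔ S = {2, 5, 8}) := by
  refine ⟨by decide +kernel, by decide +kernel⟩

set_option maxRecDepth 8000 in
set_option maxHeartbeats 1600000 in
/-- The solutions of `hodge13_iff` ARE the `G`-translates of the orbit representatives `orbitRep 1`, `orbitRep 2` of `DecicCyclicSpecies`. [folklore] -/
theorem hodge13_orbitRep :
    (∀ s : ZMod 10, {q 1 s} ∪ lab 0 {s + 1, s + 5, s + 7} = (orbitRep 1).image (act (s + 8))) ∧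
    (∀ s : ZMod 10, {q 2 s} ∪ lab 0 {s + 2, s + 5, s + 8} = (orbitRep 2).image (act (s + 9))) := by
  refine ⟨by decide +kernel, by decide +kernel⟩

set_option maxRecDepth 8000 in
set_option maxHeartbeats 1600000 in
/-- **The mirror family.**  On `B_j × B₂`: `e_{0,0} ⊗ e_{2,S}` is Hodge iff `S = {4,5,6}`, and `e_{1,0} ⊗ e_{2,S}` iff `S = {4,6,8}`; by
`hodge_translate_iff` then `e_{0,s} ⊗ e_{2,S}` iff `S = {s+4,s+5,s+6}` and `e_{1,s} ⊗ e_{2,S}` iff `S = {s+4,s+6,s+8}` — the graph orbits into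
`N₀″, N₁″ ⊂ H³(B₂)`; by `aut_three_blocks` this is the `σ ↦ σ³` mirror of `hodge13_iff`. [cite: Pohlmann1968, Thm 1] -/
theorem hodge13_mirror_iff :
    (∀ S ∈ triples, (∀ g : ZMod 10, 2 * ((if bit 0 g 0 = true then 1 else 0) + pc 2 g S) = 4) ↔ S = {4, 5, 6}) ∧
    (∀ S ∈ triples, (∀ g : ZMod 10, 2 * ((if bit 1 g 0 = true then 1 else 0) + pc 2 g S) = 4) ↔ S = {4, 6, 8}) := by
  refine ⟨by decide +kernel, by decide +kernel⟩

set_option maxRecDepth 8000 in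
set_option maxHeartbeats 1600000 in
/-- **The silent factor.**  Into `H³(B₁)` there is NO Künneth-`(1,3)` Hodge monomial `e_{j,0} ⊗ e_{1,S}` from `B₀` or `B₂`, and there is
none `e_0 ⊗ e_{i,S}` from `E` into any `H³(B_i)` — hence (by `hodge_translate_iff`: translate by `s`, resp. by `5` for `e_1 = act 5 (e 0)`) none
at all: `H³(B₁)` meets no graph class, in accordance with `h3_level_census`. [cite: Pohlmann1968, Thm 1] -/
theorem hodge13_none :
    (∀ S ∈ triples, ¬ (∀ g : ZMod 10, 2 * ((if bit 0 g 0 = true then 1 else 0) + pc 1 g S) = 4)) ∧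
    (∀ S ∈ triples, ¬ (∀ g : ZMod 10, 2 * ((if bit 2 g 0 = true then 1 else 0) + pc 1 g S) = 4)) ∧
    (∀ i : Fin 3, ∀ S ∈ triples, ¬ (∀ g : ZMod 10, 2 * ((if ebit g 0 = true then 1 else 0) + pc i g S) = 4)) := by
  refine ⟨by decide +kernel, by decide +kernel, by decide +kernel⟩

end Summit.HodgeConjecture.CorCM.Census.DecicCyclicConiveau
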